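import Summits.QuantumFields.BalabanUV.Beta.EriceFlowEnclosureB12AsPrintedHistoryContagionShiftFlowRepin

/-!
# Beta / EriceFlowEnclosureB12AsPrintedHistoryContagionShiftFlowRepinWitness — ASYMPTOTIC FREEDOM IS CONTAGIOUS, part 28: THE SMALLNESS OF THE REFERENCE SCALE IS
# LOAD-BEARING, AND RE-PINNING CAN FAIL AT SCALE ZERO.  Kernel witnesses for parts 23 and 25, BY NAME from node U2's v1.1 §7 (`T4BetaFlowWellPosed.Sharpness`): the Markov bump
# functional `bumpB u = 2 + tent (u 0)` (memory profile `(20, θ)` for every 0 ≤ θ < 1, floor 2) has from the pin 1 the two distinct box solutions `hSlow m = (1 + 2m)^{−½}` and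
# `hFast` on ]0, 1].  The slow branch is an ASYMPTOTICALLY FREE REFERENCE in the exact sense of parts 10–27 — `1∕1² + 2·m ≤ 1∕hSlow(m)²` with EQUALITY (scale t_a = 1, rate β* = 2)
# — yet the flow from ITS OWN pin has a second box solution.  HENCE (§42) part 23's `memFlow_unique_at_reference` with its three smallness hypotheses on the reference scale
# (`4C_m t_a ≤ β*(1 − θ)`, `t_a²K ≤ ½`, `16C_m t_a³ < (1 − θ)²`) DELETED — every other binder kept and universally closed — is FALSE (for the witness `4C_m t_a = 80 > 2(1 − θ)`,
# `16C_m t_a³ = 320 > (1 − θ)²`); and (§43) part 25's `eventually_wellPosed_tail` cannot in general start at n₀ = 0: its hypotheses are met by (bumpB, hSlow) while re-pinning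
# at the scale-0 value hSlow(0) = 1 is NOT well posed.  An existence question is not at issue (both branches exist); which monotonicity Bałaban's limit functional has is NOT
# PRINTED and not asserted.
# (β-flow team, prover 1, unit `b2b-balaban-beta-bflow-p1`, gen 38; ROW AP-I·Uc × NODE U2 — witnesses)

HONEST FRAMING (page 1 of everything the β sub-cell writes): discharging `BetaPertH` makes Bałaban's UV stability UNCONDITIONAL — a
real constructive-QFT result; it is NOT the continuum limit and NOT the Clay problem.  HONEST DEPENDENCY (cell reorg 2026-08-19,
verbatim): «continuum YM on T⁴ ⇐ BetaPertH ∧ nine spine estimates (0/9 proved); BetaPertH ⇐ (D1) ∧ (D4) ∧ CAP+tail; G-an2-4 gates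
asym, D1 and NE2/3/4.»  THIS MODULE DISCHARGES NOTHING: [folklore] kernel witnesses over node U2's HYPOTHESIS SHAPES, every ingredient BY NAME from node U2's
`T4BetaFlowWellPosed.Sharpness` (`bumpB`, `hSlow`, `hFast`, `ySlow`, `memoryProfile_bumpB`, `seqBox_hSlow ∕ _hFast`, `memFlow_hSlow ∕ _hFast`, `hSlow_ne_hFast`,
`one_div_one_div_sqrt_sq`, `ySlow_pos`) — a TOY functional of node U2's, NOT Bałaban's β ([I] = T. Bałaban, Commun. Math. Phys. **109** (1987) [Balaban1987RG1] prints no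
such object; the AF profile shape is that of (0.31)'s lower half, Theorem 2 p. 259, STATED WITHOUT PROOF).  Nothing of node U2's modules or of parts 1–27 is restated or modified.

WHAT THIS FILE PROVES (0 sorry, 0 def): §42 `hSlow_profile`, **`memFlow_unique_at_reference_false_without_smallness`**, `existsUnique_at_reference_false_without_smallness`;
§43 **`repin_fails_at_scale_zero`**.  NOT CLAIMED: that each of the three smallness conditions is separately necessary, or sharp; anything about Bałaban's β; `BetaPertH`; Clay.
-/

namespace Summit.QuantumFields.BalabanUV.Beta.EriceFlowEnclosureB12AsPrintedHistoryContagionShiftFlowRepinWitness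

open Literature.MathematicalPhysics.QuantumFieldTheory.Balaban1983to89
open Literature.MathematicalPhysics.QuantumFieldTheory.Balaban1983to89.T4BetaStationary (SeqBox MemoryProfile)
open Literature.MathematicalPhysics.QuantumFieldTheory.Balaban1983to89.T4BetaFlowWellPosed (MemFlow)
open Literature.MathematicalPhysics.QuantumFieldTheory.Balaban1983to89.T4BetaFlowWellPosed.Sharpness (bumpB hSlow hFast ySlow ySlow_pos memoryProfile_bumpB
  seqBox_hSlow seqBox_hFast memFlow_hSlow memFlow_hFast hSlow_ne_hFast one_div_one_div_sqrt_sq hSlow_zero)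

noncomputable section

/-! ## §42 The slow branch of node U2's bump is an AF reference whose own pin carries a second box solution -/

/-- THE SLOW BRANCH IS AN ASYMPTOTICALLY FREE REFERENCE with scale `t_a = 1` and rate `β* = 2`: `1∕1² + 2·m ≤ 1∕hSlow(m)²` (with equality). [folklore] -/
theorem hSlow_profile : ∀ m : ℕ, 1 / (1 : ℝ) ^ 2 + 2 * (m : ℝ) ≤ 1 / (hSlow m) ^ 2 := by
  intro m
  have h : 1 / (hSlow m) ^ 2 = ySlow m := by
    unfold hSlow
    exact one_div_one_div_sqrt_sq (ySlow_pos m).le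
  rw [h]
  unfold ySlow
  norm_num

/-- **`memFlow_unique_at_reference` WITHOUT ITS SMALLNESS IS FALSE**: the statement of part 23's `memFlow_unique_at_reference` with the three hypotheses on the reference scale
(`hr1 : 4C_m t_a ≤ β*(1 − θ)`, `hr2 : t_a²·(C_mγ∕(1 − θ)² + (2C_m∕((1 − θ)β*))²) ≤ ½`, `hr4 : 16C_m t_a³ < (1 − θ)²`) deleted — all other binders kept and universally quantified —
is refuted by node U2's bump: `bumpB` with profile (20, 0) on ]0, 1], the AF reference hSlow from the pin 1 (t_a = 1, β* = 2), and the second box solution hFast from the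
same pin. [folklore] -/
theorem memFlow_unique_at_reference_false_without_smallness :
    ¬ (∀ (B : (ℕ → ℝ) → ℝ) (Cm θ γ bs ta gs : ℝ) (t h : ℕ → ℝ), MemoryProfile Cm θ γ B → 0 ≤ Cm → 0 ≤ θ → θ < 1 → 0 < bs → 0 < ta →
        SeqBox γ t → MemFlow B gs t → (∀ m : ℕ, 1 / ta ^ 2 + bs * (m : ℝ) ≤ 1 / (t m) ^ 2) → SeqBox γ h → MemFlow B gs h → h = t) := fun H =>
  hSlow_ne_hFast (H bumpB 20 0 1 2 1 1 hSlow hFast (memoryProfile_bumpB le_rfl one_pos) (by norm_num) le_rfl one_pos two_pos one_pos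
    seqBox_hSlow memFlow_hSlow hSlow_profile seqBox_hFast memFlow_hFast).symm

/-- Consistency with part 23 BY NAME: for the witness all three smallness conditions indeed fail — `4·20·1 > 2(1 − θ)` and `16·20·1³ > (1 − θ)²` for every 0 ≤ θ < 1,
and `1²·(20·1∕(1 − 0)² + (2·20∕((1 − 0)·2))²) > ½`. [folklore] -/
example {θ : ℝ} (hθ0 : 0 ≤ θ) (hθ1 : θ < 1) : ¬ (4 * (20 : ℝ) * 1 ≤ 2 * (1 - θ)) ∧ ¬ (16 * (20 : ℝ) * 1 ^ 3 < (1 - θ) ^ 2) ∧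
    ¬ ((1 : ℝ) ^ 2 * (20 * 1 / (1 - 0) ^ 2 + (2 * 20 / ((1 - 0) * 2)) ^ 2) ≤ 1 / 2) :=
  ⟨fun h => by linarith, fun h => by nlinarith, fun h => by norm_num at h⟩

/-- … and `existsUnique_memFlow_at_reference` WITHOUT the smallness is false too: an AF reference does NOT by itself make its own pin well posed. [folklore] -/
theorem existsUnique_at_reference_false_without_smallness :
    ¬ (∀ (B : (ℕ → ℝ) → ℝ) (Cm θ γ bs ta gs : ℝ) (t : ℕ → ℝ), MemoryProfile Cm θ γ B → 0 ≤ Cm → 0 ≤ θ → θ < 1 → 0 < bs → 0 < ta →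
        SeqBox γ t → MemFlow B gs t → (∀ m : ℕ, 1 / ta ^ 2 + bs * (m : ℝ) ≤ 1 / (t m) ^ 2) → ∃! h : ℕ → ℝ, SeqBox γ h ∧ MemFlow B gs h) := fun H => by
  obtain ⟨h, -, huniq⟩ := H bumpB 20 0 1 2 1 1 hSlow (memoryProfile_bumpB le_rfl one_pos) (by norm_num) le_rfl one_pos two_pos one_pos
    seqBox_hSlow memFlow_hSlow hSlow_profile
  exact hSlow_ne_hFast ((huniq hSlow ⟨seqBox_hSlow, memFlow_hSlow⟩).trans (huniq hFast ⟨seqBox_hFast, memFlow_hFast⟩).symm)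

/-! ## §43 Re-pinning can fail at scale zero: part 25's n₀ is not always 0 -/

/-- **THE EVENTUAL STATEMENT CANNOT IN GENERAL START AT n₀ = 0.**  There are a functional with a memory profile on a box and an asymptotically free box solution t of its flow
— the data of part 25's `eventually_wellPosed_tail` — such that the flow re-pinned at the scale-0 value t(0) has a box solution OTHER than the tail `t(0 + ·) = t`: node U2's
bump with its slow branch as the trajectory and its fast branch as the intruder. [folklore] -/
theorem repin_fails_at_scale_zero :
    ∃ (B : (ℕ → ℝ) → ℝ) (Cm θ γ bs ta gs : ℝ) (t h : ℕ → ℝ), MemoryProfile Cm θ γ B ∧ 0 ≤ Cm ∧ 0 ≤ θ ∧ θ < 1 ∧ 0 < bs ∧ 0 < ta ∧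
      SeqBox γ t ∧ MemFlow B gs t ∧ (∀ m : ℕ, 1 / ta ^ 2 + bs * (m : ℝ) ≤ 1 / (t m) ^ 2) ∧
      SeqBox γ h ∧ MemFlow B (t 0) h ∧ h ≠ fun j => t (0 + j) := by
  refine ⟨bumpB, 20, 0, 1, 2, 1, 1, hSlow, hFast, memoryProfile_bumpB le_rfl one_pos, by norm_num, le_rfl, one_pos, two_pos, one_pos,
    seqBox_hSlow, memFlow_hSlow, hSlow_profile, seqBox_hFast, ?_, ?_⟩
  · rw [hSlow_zero]; exact memFlow_hFast
  · intro heq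
    apply hSlow_ne_hFast
    rw [heq]
    funext j
    rw [Nat.zero_add]

end

end Summit.QuantumFields.BalabanUV.Beta.EriceFlowEnclosureB12AsPrintedHistoryContagionShiftFlowRepinWitness
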